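import Literature.Computability.QuantumComplexity.AaronsonAmbainisSimTreeBounds
import HarnessLib

/-!
# Crux `TransferPB` (stmt-QuantumAdvantage-15238, route SosSandwich), line `birth` — ADVISED simulation trees (the robust form of Aaronson–Ambainis' Thm 21 that a gapped promise oracle can drive)

Toward the MACHINE half of stub `stub_pbOracleSimulation` (Aaronson–Ambainis 2014 Thm. 23 relative to a
promise-`BQP` oracle). A polynomial-time machine cannot evaluate the node quantities `Var[p_j]`, `Inf_i[p_j]`,
`E[p_j]` of the simulation tree `ClassicalSimulation.simTree` exactly; with a PROMISE oracle it only receives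
GAPPED answers (correct when `Inf_i ≥ w` or `Inf_i ≤ w/2`, arbitrary in between) that may moreover depend on
the query PATH (the instance encodes the sequence of revealed bits), and leaf values to precision `η`. This
file isolates what the analysis of Thm. 21 actually uses: an ADVISOR — any path-indexed rule `pick` (which
variable to query next, if any) and `val` (the leaf value) — that is SOUND for `p` with parameters `(θ, w, η)`:
a picked variable has influence `≥ w` in the current restriction, a refusal to pick certifies variance
`≤ θ`, and leaf values are `η`-close to the current mean. For every sound advisor the advised tree
`advTree` obeys the same two counting bounds as `simTree` (potential argument, Chebyshev at the leaves),
hence the same depth/error trade-off: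

* `restrictPath`, `advTree` (definitions); `restrictPath_append`, bookkeeping of degree / values / ignored
  variables along a path;
* `advTree_flipBit` — a sound advisor never re-queries a variable (its influence is `0 < w`), so subtrees
  ignore queried bits;
* `sum_cost_advTree_mul_le` — `w · ∑_x #queries(x) ≤ 2^N · Inf[p|_ρ]`;
* `haltError_advTree_le` — `#{x : halts early, |output − p|_ρ(x)| > ε + η} · ε² ≤ 2^N θ`;
* **`advTree_error_le`** — with budget `D ≥ 8d/(wδ)` and `θ = ε²δ/2`, for `p` of degree `≤ d` with values
  in `[0,1]`: `#{x : |advTree(x) − p(x)| > ε + η} ≤ δ · 2^N`.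

All proved, for an ABSTRACT advisor (no machines, no oracle here); the proofs are those of
`ClassicalSimulation.sum_cost_simTree_mul_le` / `haltError_simTree_le` / `simTree_depth_error_le`
(`AaronsonAmbainisProofs.lean`, `AaronsonAmbainisSimTreeBounds.lean`) transcribed to path-indexed trees.
Source: S. Aaronson, A. Ambainis, Theory Comput. 10 (2014), Thm. 21 (arXiv:0911.0996v3 pp. 13–14) and the
remark in the proof of Thm. 23 (p. 14) that the node quantities need only be estimated.
-/

-- D-0017: single-conjunct summit ⇒ the duplicate `QuantumAdvantage.QuantumAdvantage` is mandated.
set_option linter.dupNamespace false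

noncomputable section

namespace Summit.QuantumAdvantage.QuantumAdvantage.Cruxes.TransferPB.Birth

open Finset Literature.Computability.QuantumComplexity Literature.Computability.QuantumComplexity.ClassicalSimulation

namespace SimTreePB

variable {N : ℕ}

/-! ### Restriction along a path -/

/-- The restriction of `p` along a path of revealed bits `ρ = [(i₁,b₁), …, (i_k,b_k)]` (first entry applied
first): `p|_{x_{i₁} := b₁}|… `. [cite: AaronsonAmbainis2014, Thm. 21 (proof: p_{j+1} := p_j restricted)] -/
def restrictPath : List (Fin N × Bool) → MvPolynomial (Fin N) ℝ → MvPolynomial (Fin N) ℝ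
  | [], p => p
  | e :: ρ, p => restrictPath ρ (restrictPoly e.1 e.2 p)

/-- Empty path. [folklore] -/
@[simp] theorem restrictPath_nil (p : MvPolynomial (Fin N) ℝ) : restrictPath [] p = p := rfl

/-- One more revealed bit at the front. [folklore] -/
@[simp] theorem restrictPath_cons (e : Fin N × Bool) (ρ : List (Fin N × Bool)) (p : MvPolynomial (Fin N) ℝ) :
    restrictPath (e :: ρ) p = restrictPath ρ (restrictPoly e.1 e.2 p) := rfl

/-- One more revealed bit at the end. [folklore] -/
theorem restrictPath_append (ρ : List (Fin N × Bool)) (i : Fin N) (b : Bool) :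
    ∀ p : MvPolynomial (Fin N) ℝ, restrictPath (ρ ++ [(i, b)]) p = restrictPoly i b (restrictPath ρ p) := by
  induction ρ with
  | nil => intro p; rfl
  | cons e ρ ih => intro p; simp [ih]

/-- Degrees do not increase along a path. [folklore] -/
theorem totalDegree_restrictPath_le : ∀ (ρ : List (Fin N × Bool)) (p : MvPolynomial (Fin N) ℝ),
    (restrictPath ρ p).totalDegree ≤ p.totalDegree
  | [], _ => le_rfl
  | e :: ρ, p => (totalDegree_restrictPath_le ρ _).trans (totalDegree_restrictPoly_le e.1 e.2 p)

/-- Values in `[0,1]` are preserved along a path. [folklore] -/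
theorem restrictPath_bound : ∀ (ρ : List (Fin N × Bool)) {p : MvPolynomial (Fin N) ℝ},
    (∀ x, 0 ≤ evalBool p x ∧ evalBool p x ≤ 1) → ∀ x, 0 ≤ evalBool (restrictPath ρ p) x ∧ evalBool (restrictPath ρ p) x ≤ 1
  | [], _, h => h
  | e :: ρ, _, h => restrictPath_bound ρ (restrictPoly_bound h e.1 e.2)

/-- A polynomial ignoring `xᵢ` keeps ignoring it after a restriction. [folklore] -/
theorem restrictPoly_ignores {i : Fin N} (j : Fin N) (b : Bool) {p : MvPolynomial (Fin N) ℝ}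
    (h : ∀ x, evalBool p (flipBit i x) = evalBool p x) :
    ∀ x, evalBool (restrictPoly j b p) (flipBit i x) = evalBool (restrictPoly j b p) x := by
  intro x
  by_cases hji : j = i
  · subst hji
    exact evalBool_restrictPoly_flipBit j b p x
  · rw [evalBool_restrictPoly, evalBool_restrictPoly, update_flipBit_comm (Ne.symm hji)]
    exact h _

/-- … and after a path of restrictions. [folklore] -/
theorem restrictPath_ignores {i : Fin N} : ∀ (ρ : List (Fin N × Bool)) {p : MvPolynomial (Fin N) ℝ},
    (∀ x, evalBool p (flipBit i x) = evalBool p x) →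
      ∀ x, evalBool (restrictPath ρ p) (flipBit i x) = evalBool (restrictPath ρ p) x
  | [], _, h => h
  | e :: ρ, _, h => restrictPath_ignores ρ (restrictPoly_ignores e.1 e.2 h)

/-- A polynomial ignoring `xᵢ` has `Inf_i = 0`. [folklore] -/
theorem influence_eq_zero_of_ignores {i : Fin N} {p : MvPolynomial (Fin N) ℝ}
    (h : ∀ x, evalBool p (flipBit i x) = evalBool p x) : influence i p = 0 := by
  unfold influence boolAvg
  simp [h]

/-! ### Advised trees -/

/-- **An advisor**: a path-indexed rule saying which variable to query next (`pick ρ = some i`) or to stop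
(`none`), and the value to output at a leaf reached along `ρ`. (What a machine with a gapped promise oracle
extracts; Aaronson–Ambainis' `simTree` is the advisor "least `i` with `Inf_i ≥ w` if `Var > θ`", `val = E`.)
[cite: AaronsonAmbainis2014, Thm. 21 (proof) and Thm. 23 (proof, p. 14)] -/
structure Advisor (N : ℕ) where
  /-- the next variable to query after the path `ρ`, if any -/
  pick : List (Fin N × Bool) → Option (Fin N)
  /-- the output at a leaf reached along `ρ` -/
  val : List (Fin N × Bool) → ℝ

/-- **The advised tree** with budget `D` from the path `ρ`: stop with `val ρ` when the budget is exhausted or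
the advisor refuses to pick; otherwise query the picked variable and continue on the extended path.
[cite: AaronsonAmbainis2014, Thm. 21 (proof)] -/
def advTree (A : Advisor N) : ℕ → List (Fin N × Bool) → RealDecisionTree N
  | 0, ρ => .leaf (A.val ρ)
  | D + 1, ρ =>
    match A.pick ρ with
    | none => .leaf (A.val ρ)
    | some i => .query i (advTree A D (ρ ++ [(i, false)])) (advTree A D (ρ ++ [(i, true)]))

/-- **Soundness of an advisor for `p` with parameters `(θ, w, η)`**: a picked variable has influence `≥ w` in
the current restriction; a refusal certifies variance `≤ θ`; leaf values are `η`-accurate means. (A proof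
device of this file: the three properties the analysis of Aaronson–Ambainis' Thm. 21 consumes.) -/
def Advisor.Sound (A : Advisor N) (p : MvPolynomial (Fin N) ℝ) (θ w η : ℝ) : Prop :=
  (∀ (ρ : List (Fin N × Bool)) (i : Fin N), A.pick ρ = some i → w ≤ influence i (restrictPath ρ p)) ∧
  (∀ ρ : List (Fin N × Bool), A.pick ρ = none → boolVariance (restrictPath ρ p) ≤ θ) ∧
  (∀ ρ : List (Fin N × Bool), |A.val ρ - boolAvg (evalBool (restrictPath ρ p))| ≤ η)

variable (A : Advisor N)

/-- Budget exhausted: a leaf. [folklore] -/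
@[simp] theorem advTree_zero (ρ : List (Fin N × Bool)) : advTree A 0 ρ = .leaf (A.val ρ) := rfl

/-- Refusal: a leaf. [folklore] -/
theorem advTree_succ_of_none {D : ℕ} {ρ : List (Fin N × Bool)} (h : A.pick ρ = none) :
    advTree A (D + 1) ρ = .leaf (A.val ρ) := by
  simp [advTree, h]

/-- Query step. [folklore] -/
theorem advTree_succ_of_some {D : ℕ} {ρ : List (Fin N × Bool)} {i : Fin N} (h : A.pick ρ = some i) :
    advTree A (D + 1) ρ = .query i (advTree A D (ρ ++ [(i, false)])) (advTree A D (ρ ++ [(i, true)])) := by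
  simp [advTree, h]

/-- Every path has length `≤ D`. [folklore] -/
theorem cost_advTree_le : ∀ (D : ℕ) (ρ : List (Fin N × Bool)) (x : Fin N → Bool), (advTree A D ρ).cost x ≤ D
  | 0, ρ, x => by simp
  | D + 1, ρ, x => by
    cases hp : A.pick ρ with
    | none => rw [advTree_succ_of_none A hp]; simp
    | some i =>
      rw [advTree_succ_of_some A hp, RealDecisionTree.cost_query]
      have h0 := cost_advTree_le D (ρ ++ [(i, false)]) x
      have h1 := cost_advTree_le D (ρ ++ [(i, true)]) x
      cases x i <;> simp <;> omega

/-- The depth is `≤ D`. [folklore] -/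
theorem depth_advTree_le : ∀ (D : ℕ) (ρ : List (Fin N × Bool)), (advTree A D ρ).depth ≤ D
  | 0, ρ => by simp
  | D + 1, ρ => by
    cases hp : A.pick ρ with
    | none => rw [advTree_succ_of_none A hp]; simp
    | some i =>
      rw [advTree_succ_of_some A hp, RealDecisionTree.depth_query]
      have h0 := depth_advTree_le D (ρ ++ [(i, false)])
      have h1 := depth_advTree_le D (ρ ++ [(i, true)])
      omega

variable {A} {p : MvPolynomial (Fin N) ℝ} {θ w η : ℝ}

/-- **A sound advisor never re-queries a variable**: if `p|_ρ` ignores `xᵢ` then the output and the path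
length of the advised tree from `ρ` are invariant under flipping `xᵢ` (a variable of influence `0 < w` is not
picked, and extensions of `ρ` keep ignoring `xᵢ`). [cite: AaronsonAmbainis2014, Thm. 21 (proof)] -/
theorem advTree_flipBit (hS : A.Sound p θ w η) (hw : 0 < w) (i : Fin N) :
    ∀ (D : ℕ) (ρ : List (Fin N × Bool)), (∀ x, evalBool (restrictPath ρ p) (flipBit i x) = evalBool (restrictPath ρ p) x) →
      ∀ x, (advTree A D ρ).eval (flipBit i x) = (advTree A D ρ).eval x ∧
        (advTree A D ρ).cost (flipBit i x) = (advTree A D ρ).cost x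
  | 0, ρ, _, x => by simp
  | D + 1, ρ, hinv, x => by
    cases hp : A.pick ρ with
    | none => rw [advTree_succ_of_none A hp]; simp
    | some j =>
      rw [advTree_succ_of_some A hp]
      have hji : j ≠ i := by
        intro hji
        subst hji
        have h0 : influence j (restrictPath ρ p) = 0 := influence_eq_zero_of_ignores hinv
        have := hS.1 ρ j hp
        linarith
      have hinv' : ∀ (b : Bool) (y : Fin N → Bool),
          evalBool (restrictPath (ρ ++ [(j, b)]) p) (flipBit i y) = evalBool (restrictPath (ρ ++ [(j, b)]) p) y := by
        intro b y
        rw [restrictPath_append]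
        exact restrictPoly_ignores j b hinv y
      have IH0 := advTree_flipBit hS hw i D (ρ ++ [(j, false)]) (hinv' false) x
      have IH1 := advTree_flipBit hS hw i D (ρ ++ [(j, true)]) (hinv' true) x
      simp only [RealDecisionTree.eval_query, RealDecisionTree.cost_query, flipBit_apply_of_ne hji]
      cases x j <;> simp [IH0.1, IH0.2, IH1.1, IH1.2]

/-- **Expected number of queries of an advised tree** (the potential argument): for a sound advisor,
`w · ∑_x #queries(x) ≤ 2^N · Inf[p|_ρ]`. [cite: AaronsonAmbainis2014, Thm. 21 (proof, pp. 13–14)] -/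
theorem sum_cost_advTree_mul_le (hS : A.Sound p θ w η) (hw : 0 < w) :
    ∀ (D : ℕ) (ρ : List (Fin N × Bool)),
      (∑ x, ((advTree A D ρ).cost x : ℝ)) * w ≤ 2 ^ N * ∑ j, influence j (restrictPath ρ p)
  | 0, ρ => by
    simp only [advTree_zero, RealDecisionTree.cost_leaf, Nat.cast_zero, Finset.sum_const_zero, zero_mul]
    exact mul_nonneg (by positivity) (Finset.sum_nonneg fun j _ => influence_nonneg j _)
  | D + 1, ρ => by
    cases hp : A.pick ρ with
    | none =>
      rw [advTree_succ_of_none A hp]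
      simp only [RealDecisionTree.cost_leaf, Nat.cast_zero, Finset.sum_const_zero, zero_mul]
      exact mul_nonneg (by positivity) (Finset.sum_nonneg fun j _ => influence_nonneg j _)
    | some i =>
      rw [advTree_succ_of_some A hp]
      set T0 := advTree A D (ρ ++ [(i, false)]) with hT0
      set T1 := advTree A D (ρ ++ [(i, true)]) with hT1
      have IH0 := sum_cost_advTree_mul_le hS hw D (ρ ++ [(i, false)])
      have IH1 := sum_cost_advTree_mul_le hS hw D (ρ ++ [(i, true)])
      rw [← hT0, restrictPath_append] at IH0
      rw [← hT1, restrictPath_append] at IH1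
      set q := restrictPath ρ p with hq
      have hinv0 : ∀ x, (T0.cost (flipBit i x) : ℝ) = T0.cost x := fun x => by
        rw [(advTree_flipBit hS hw i D (ρ ++ [(i, false)])
          (fun y => by rw [restrictPath_append]; exact evalBool_restrictPoly_flipBit i false q y) x).2]
      have hinv1 : ∀ x, (T1.cost (flipBit i x) : ℝ) = T1.cost x := fun x => by
        rw [(advTree_flipBit hS hw i D (ρ ++ [(i, true)])
          (fun y => by rw [restrictPath_append]; exact evalBool_restrictPoly_flipBit i true q y) x).2]
      have hsplit : ∑ x : Fin N → Bool, (((if x i then T1.cost x else T0.cost x) + 1 : ℕ) : ℝ) =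
          (∑ x, (T0.cost x : ℝ)) / 2 + (∑ x, (T1.cost x : ℝ)) / 2 + 2 ^ N := by
        rw [← sum_ite_apply_eq_half i false hinv0, ← sum_ite_apply_eq_half i true hinv1,
          ← Finset.sum_add_distrib, ← mul_one ((2 : ℝ) ^ N), ← sum_const_cube,
          ← Finset.sum_add_distrib]
        refine Finset.sum_congr rfl fun x _ => ?_
        cases x i <;> simp
      have hkey : (2 : ℝ) ^ N * ∑ j, influence j (restrictPoly i false q) +
          2 ^ N * ∑ j, influence j (restrictPoly i true q) =
            2 ^ N * (2 * (∑ j, influence j q - influence i q)) := by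
        rw [← mul_add, sum_influence_restrictPoly_add]
      have hwi : (2 : ℝ) ^ N * w ≤ 2 ^ N * influence i q :=
        mul_le_mul_of_nonneg_left (hS.1 ρ i hp) (by positivity)
      simp only [RealDecisionTree.cost_query]
      rw [hsplit]
      nlinarith [IH0, IH1, hkey, hwi]

/-- **Correctness when halting, advised form** (Chebyshev at the refusal leaves, with the leaf-value
slack `η`): for a sound advisor, the inputs whose path halts within the budget and whose output errs from
`p|_ρ` by more than `ε + η` number at most `2^N θ/ε²`. [cite: AaronsonAmbainis2014, Thm. 21 (proof, pp. 13–14)] -/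
theorem haltError_advTree_le (hS : A.Sound p θ w η) (hw : 0 < w) (hθ : 0 ≤ θ) {ε : ℝ} (hε : 0 < ε) :
    ∀ (D : ℕ) (ρ : List (Fin N × Bool)),
      (∑ x, if (advTree A D ρ).cost x < D ∧ ε + η < |(advTree A D ρ).eval x - evalBool (restrictPath ρ p) x|
        then (1 : ℝ) else 0) * ε ^ 2 ≤ 2 ^ N * θ
  | 0, ρ => by
    simp only [Nat.not_lt_zero, false_and, if_false, Finset.sum_const_zero, zero_mul]
    positivity
  | D + 1, ρ => by
    cases hp : A.pick ρ with
    | none =>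
      rw [advTree_succ_of_none A hp]
      set q := restrictPath ρ p with hq
      have hvar : boolVariance q ≤ θ := hS.2.1 ρ hp
      have hval : |A.val ρ - boolAvg (evalBool q)| ≤ η := hS.2.2 ρ
      simp only [RealDecisionTree.cost_leaf, Nat.zero_lt_succ, true_and, RealDecisionTree.eval_leaf]
      calc (∑ x, if ε + η < |A.val ρ - evalBool q x| then (1 : ℝ) else 0) * ε ^ 2
          = ∑ x, (if ε + η < |A.val ρ - evalBool q x| then ε ^ 2 else 0) := by
            rw [Finset.sum_mul]
            refine Finset.sum_congr rfl fun x _ => ?_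
            split_ifs <;> simp
        _ ≤ ∑ x, (evalBool q x - boolAvg (evalBool q)) ^ 2 := by
            refine Finset.sum_le_sum fun x _ => ?_
            split_ifs with hx
            · have htri : |A.val ρ - evalBool q x| ≤ |A.val ρ - boolAvg (evalBool q)| + |boolAvg (evalBool q) - evalBool q x| := by
                have := abs_sub_le (A.val ρ) (boolAvg (evalBool q)) (evalBool q x)
                exact this
              have hx' : ε < |boolAvg (evalBool q) - evalBool q x| := by linarith
              have h1 : ε ^ 2 ≤ |boolAvg (evalBool q) - evalBool q x| ^ 2 :=
                pow_le_pow_left₀ hε.le hx'.le 2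
              rw [sq_abs] at h1
              nlinarith [h1]
            · positivity
        _ = 2 ^ N * boolVariance q := by
            have h2 : (2 : ℝ) ^ N ≠ 0 := by positivity
            have hmul : ∀ s : ℝ, 2 ^ N * (s / 2 ^ N) = s := fun s => mul_div_cancel₀ s h2
            show _ = 2 ^ N * ((∑ x, (evalBool q x - boolAvg (evalBool q)) ^ 2) / 2 ^ N)
            rw [hmul]
        _ ≤ 2 ^ N * θ := by gcongr
    | some i =>
      rw [advTree_succ_of_some A hp]
      set q := restrictPath ρ p with hq
      set T0 := advTree A D (ρ ++ [(i, false)]) with hT0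
      set T1 := advTree A D (ρ ++ [(i, true)]) with hT1
      have IH0 := haltError_advTree_le hS hw hθ hε D (ρ ++ [(i, false)])
      have IH1 := haltError_advTree_le hS hw hθ hε D (ρ ++ [(i, true)])
      rw [← hT0, restrictPath_append, ← hq] at IH0
      rw [← hT1, restrictPath_append, ← hq] at IH1
      set G0 : (Fin N → Bool) → ℝ := fun x =>
        if T0.cost x < D ∧ ε + η < |T0.eval x - evalBool (restrictPoly i false q) x| then (1 : ℝ) else 0 with hG0
      set G1 : (Fin N → Bool) → ℝ := fun x =>
        if T1.cost x < D ∧ ε + η < |T1.eval x - evalBool (restrictPoly i true q) x| then (1 : ℝ) else 0 with hG1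
      have hinv0 : ∀ x, G0 (flipBit i x) = G0 x := fun x => by
        have hf := advTree_flipBit hS hw i D (ρ ++ [(i, false)])
          (fun y => by rw [restrictPath_append]; exact evalBool_restrictPoly_flipBit i false q y) x
        simp only [hG0]
        rw [hf.1, hf.2, evalBool_restrictPoly_flipBit]
      have hinv1 : ∀ x, G1 (flipBit i x) = G1 x := fun x => by
        have hf := advTree_flipBit hS hw i D (ρ ++ [(i, true)])
          (fun y => by rw [restrictPath_append]; exact evalBool_restrictPoly_flipBit i true q y) x
        simp only [hG1]
        rw [hf.1, hf.2, evalBool_restrictPoly_flipBit]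
      have hpt : ∀ x : Fin N → Bool,
          (if (RealDecisionTree.query i T0 T1).cost x < D + 1 ∧
              ε + η < |(RealDecisionTree.query i T0 T1).eval x - evalBool q x| then (1 : ℝ) else 0) =
            (if x i = false then G0 x else 0) + (if x i = true then G1 x else 0) := by
        intro x
        simp only [RealDecisionTree.cost_query, RealDecisionTree.eval_query, hG0, hG1]
        by_cases hxi : x i = true
        · have hx : Function.update x i true = x := by rw [← hxi, Function.update_eq_self]
          simp [evalBool_restrictPoly, hx, hxi]
        · have hxi' : x i = false := by simpa using hxi
          have hx : Function.update x i false = x := by rw [← hxi', Function.update_eq_self]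
          simp [evalBool_restrictPoly, hx, hxi']
      rw [Finset.sum_congr rfl (fun x _ => hpt x), Finset.sum_add_distrib,
        sum_ite_apply_eq_half i false hinv0, sum_ite_apply_eq_half i true hinv1]
      nlinarith [IH0, IH1]

/-- **Error bound for advised trees.** For a sound advisor for `p` (degree `≤ d`, `d ≥ 1`, values in `[0,1]`) with
parameters `θ = ε²δ/2`, `w > 0`, `η`, and a budget `D ≥ 8d/(wδ)`: the advised tree from the empty path errs
from `p` by more than `ε + η` on at most `δ · 2^N` inputs (Chebyshev at the leaves + the potential/Markov bound
on budget exhaustion, `Σ_i Inf_i[p] ≤ 4d`). [cite: AaronsonAmbainis2014, Thm. 21 (proof, pp. 13–14)] -/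
theorem advTree_error_le {d : ℕ} (hd1 : 1 ≤ d) (hdeg : p.totalDegree ≤ d) (hbd : ∀ x, 0 ≤ evalBool p x ∧ evalBool p x ≤ 1)
    {ε δ : ℝ} (hε : 0 < ε) (hδ : 0 < δ) (hw : 0 < w) (hS : A.Sound p (ε ^ 2 * δ / 2) w η)
    {D : ℕ} (hD : 8 * (d : ℝ) / (w * δ) ≤ D) :
    ((univ.filter fun x : Fin N → Bool => ε + η < |(advTree A D []).eval x - evalBool p x|).card : ℝ) ≤
      δ * 2 ^ N := by
  set θ : ℝ := ε ^ 2 * δ / 2 with hθ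
  have hθpos : 0 < θ := by positivity
  set t := advTree A D [] with ht
  have hA := sum_cost_advTree_mul_le hS hw D []
  have hB := haltError_advTree_le hS hw hθpos.le hε D []
  rw [← ht, restrictPath_nil] at hA hB
  have hM := t.markov_cost D
  have hI : ∑ j, influence j p ≤ 4 * d := sum_influence_le hdeg hbd
  have hpt : ∀ x, (if ε + η < |t.eval x - evalBool p x| then (1 : ℝ) else 0) ≤
      (if t.cost x < D ∧ ε + η < |t.eval x - evalBool p x| then (1 : ℝ) else 0) +
        (if t.cost x = D then (1 : ℝ) else 0) := by
    intro x
    have hc : t.cost x ≤ D := cost_advTree_le A D [] x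
    rcases hc.lt_or_eq with hlt | heq
    · by_cases hb : ε + η < |t.eval x - evalBool p x| <;> simp [hlt, hlt.ne, hb]
    · by_cases hb : ε + η < |t.eval x - evalBool p x| <;> simp [heq, hb]
  have hcard : ((Finset.univ.filter fun x : Fin N → Bool =>
      ε + η < |t.eval x - evalBool p x|).card : ℝ) =
        ∑ x, (if ε + η < |t.eval x - evalBool p x| then (1 : ℝ) else 0) := by
    rw [Finset.natCast_card_filter]
  rw [hcard]
  set S1 : ℝ := ∑ x, (if t.cost x < D ∧ ε + η < |t.eval x - evalBool p x| then (1 : ℝ) else 0) with hS1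
  set S2 : ℝ := ∑ x, (if t.cost x = D then (1 : ℝ) else 0) with hS2
  have hsum : ∑ x, (if ε + η < |t.eval x - evalBool p x| then (1 : ℝ) else 0) ≤ S1 + S2 := by
    rw [hS1, hS2, ← Finset.sum_add_distrib]
    exact Finset.sum_le_sum fun x _ => hpt x
  have h1 : S1 ≤ 2 ^ N * (δ / 2) := by
    have hε2 : 0 < ε ^ 2 := by positivity
    have : S1 * ε ^ 2 ≤ 2 ^ N * (δ / 2) * ε ^ 2 := by
      calc S1 * ε ^ 2 ≤ 2 ^ N * θ := hB
        _ = 2 ^ N * (δ / 2) * ε ^ 2 := by rw [hθ]; ring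
    exact le_of_mul_le_mul_right this hε2
  have h2 : S2 ≤ 2 ^ N * (δ / 2) := by
    have hdpos : (0 : ℝ) < d := by exact_mod_cast hd1
    have hS2D : (D : ℝ) * S2 * w ≤ 2 ^ N * (4 * d) := by
      calc (D : ℝ) * S2 * w ≤ (∑ x, (t.cost x : ℝ)) * w := mul_le_mul_of_nonneg_right hM hw.le
        _ ≤ 2 ^ N * ∑ j, influence j p := hA
        _ ≤ 2 ^ N * (4 * d) := by gcongr
    have hDw : 8 * d ≤ (D : ℝ) * (w * δ) := (div_le_iff₀ (by positivity)).mp hD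
    have hS2nn : 0 ≤ S2 := Finset.sum_nonneg fun x _ => by positivity
    have h3 : 8 * (d : ℝ) * S2 ≤ (D : ℝ) * (w * δ) * S2 := mul_le_mul_of_nonneg_right hDw hS2nn
    have h5 : (D : ℝ) * S2 * w * δ ≤ 2 ^ N * (4 * d) * δ := mul_le_mul_of_nonneg_right hS2D hδ.le
    have h7 : S2 * (8 * d) ≤ 2 ^ N * (δ / 2) * (8 * d) := by linarith
    exact le_of_mul_le_mul_right h7 (by positivity)
  linarith

end SimTreePB

end Summit.QuantumAdvantage.QuantumAdvantage.Cruxes.TransferPB.Birth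

end
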